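import Summits.QuantumAdvantage.QuantumAdvantage.Theorems.SymplecticPurityCubeGraphFlat
import Summits.QuantumAdvantage.QuantumAdvantage.Theorems.SymplecticPurityCubeAlmostBent
import Summits.QuantumAdvantage.QuantumAdvantage.Theorems.SymplecticPurityGraphStateSpectrum

/-!
# Crux `DeqThesis`, line `Sketch` — real-tilt / trace-orthonormal core, file 1/4: vocabulary and dictionary

Lead's sub-goal `stub_coreFlatRealSelfDual` toward the open core stub `stub_coreFlat` (Cruxes/DeqThesis/Lines/Sketch.lean,
Lines/Sketch.md §3): flatness of the normalised cube graph state against REAL (X–Z-plane) product tests of arbitrary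
support, in TRACE-ORTHONORMAL coordinates `Σᵢ[x]ᵢ[y]ᵢ = Tr(xy)`, rate `2^{-n/10}` for `n ≥ 200`.

This file: the vocabulary (`refl`, `siteOp`, `toK`, `cubeCoords`, `graphVec`, product weights `pw`, signs `sgn`, the
value-difference pattern `T`, supports `inSupp`/`outSupp`, the pair sum `J`, `bits`, `bitsEquiv`, `coordSum`) and the
Bool/`ZMod 2`/field dictionary (`T_eq_bits`: the value difference along `d` is the bit pattern of `(u+α)³ + u³`;
`sgn_bits_eq`: the sign factors are characters of coordinate-sum functionals). Registered alias: `stub_coreRealDictionary`.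
-/

set_option linter.dupNamespace false -- D-0017: single-problem summit ⇒ `QuantumAdvantage.QuantumAdvantage` by design

noncomputable section

namespace Summit.QuantumAdvantage.QuantumAdvantage.Theorems.SymplecticPurity

open Matrix Finset
open Literature.Computability.QuantumComplexity Literature.Computability.Cryptography

namespace CoreReal

variable {n : ℕ}

/-- The real reflection `c Z + s X` as a `Bool`-indexed complex matrix. -/
def refl (c s : ℝ) : Matrix Bool Bool ℂ :=
  Matrix.of fun a b : Bool => if a = b then (if a then -((c : ℝ) : ℂ) else ((c : ℝ) : ℂ)) else ((s : ℝ) : ℂ)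

/-- The site operators of the test: reflections on `A`, identity elsewhere. -/
def siteOp (A : Finset (Fin (n + n))) (c s : Fin (n + n) → ℝ) (k : Fin (n + n)) : Matrix Bool Bool ℂ :=
  if k ∈ A then refl (c k) (s k) else 1

/-- Bits to field element through `e`. -/
def toK {K : Type*} [AddCommGroup K] (e : K ≃+ (Fin n → ZMod 2)) (y : Fin n → Bool) : K :=
  e.symm fun i => if y i then 1 else 0

/-- The value-register map in coordinates: `y ↦ [ (toK y)³ ]`. -/
def cubeCoords {K : Type*} [Field K] (e : K ≃+ (Fin n → ZMod 2)) (y : Fin n → Bool) : Fin n → Bool :=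
  fun j => decide (e ((toK e y) ^ 3) j = 1)

/-- The 0/1 graph vector of `cubeCoords`. -/
def graphVec {K : Type*} [Field K] (e : K ≃+ (Fin n → ZMod 2)) : QReg (n + n) → ℂ :=
  fun w => if (fun j : Fin n => w (Fin.natAdd n j)) = cubeCoords e (fun i : Fin n => w (Fin.castAdd n i))
    then (1 : ℂ) else 0

/-- Product weight of a flip pattern on one register (`0` if the pattern leaves the support). -/
def pw (S : Finset (Fin n)) (c s : Fin n → ℝ) (d : Fin n → Bool) : ℝ :=
  ∏ i, (if i ∈ S then (if d i then s i else c i) else (if d i then 0 else 1))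

/-- Sign of the diagonal factors: `(−1)^{#{i ∈ S : ¬ d i ∧ y i}}`. -/
def sgn (S : Finset (Fin n)) (d y : Fin n → Bool) : ℝ :=
  ∏ i, (if (i ∈ S ∧ d i = false ∧ y i = true) then (-1 : ℝ) else 1)

/-- The value-register difference pattern along the data difference `d`. -/
def T {K : Type*} [Field K] (e : K ≃+ (Fin n → ZMod 2)) (d y : Fin n → Bool) : Fin n → Bool :=
  fun j => Bool.xor (cubeCoords e y j) (cubeCoords e (fun i => Bool.xor (y i) (d i)) j)

/-- The input / output supports of `A`. -/
def inSupp (A : Finset (Fin (n + n))) : Finset (Fin n) := Finset.univ.filter fun i => Fin.castAdd n i ∈ A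
/-- The output support of `A`. -/
def outSupp (A : Finset (Fin (n + n))) : Finset (Fin n) := Finset.univ.filter fun j => Fin.natAdd n j ∈ A

/-- `J d` — the pair sum along the data difference `d`. -/
def J {K : Type*} [Field K] (e : K ≃+ (Fin n → ZMod 2)) (A : Finset (Fin (n + n)))
    (c s : Fin (n + n) → ℝ) (d : Fin n → Bool) : ℝ :=
  ∑ y : Fin n → Bool, sgn (inSupp A) d y *
    (pw (outSupp A) (fun j => c (Fin.natAdd n j)) (fun j => s (Fin.natAdd n j)) (T e d y) *
      sgn (outSupp A) (T e d y) (cubeCoords e y))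

section Statements

variable {K : Type} [Field K] [Fintype K] [Algebra (ZMod 2) K]

omit [Fintype K] [Algebra (ZMod 2) K] in
/-- Membership in `inSupp`. -/
theorem mem_inSupp (A : Finset (Fin (n + n))) (i : Fin n) : i ∈ inSupp A ↔ Fin.castAdd n i ∈ A := by
  simp [inSupp]

omit [Fintype K] [Algebra (ZMod 2) K] in
/-- Membership in `outSupp`. -/
theorem mem_outSupp (A : Finset (Fin (n + n))) (j : Fin n) : j ∈ outSupp A ↔ Fin.natAdd n j ∈ A := by
  simp [outSupp]

omit [Fintype K] [Algebra (ZMod 2) K] in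
/-- One site of the test along a flip `δ`: entry `(a, a ⊕ δ)` = weight factor × sign factor. -/
theorem siteOp_apply_xor (A : Finset (Fin (n + n))) (c s : Fin (n + n) → ℝ) (k : Fin (n + n))
    (a δ : Bool) :
    siteOp A c s k a (Bool.xor a δ) =
      (((if k ∈ A then (if δ then s k else c k) else (if δ then 0 else 1) : ℝ) : ℂ)) *
        (((if (k ∈ A ∧ δ = false ∧ a = true) then (-1 : ℝ) else 1 : ℝ) : ℂ)) := by
  by_cases hk : k ∈ A <;> cases a <;> cases δ <;>
    simp [siteOp, refl, hk, Matrix.of_apply, Matrix.one_apply]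

/-- The `xor`-translate equivalence of bit strings. -/
def xorEquiv (x : Fin n → Bool) : (Fin n → Bool) ≃ (Fin n → Bool) where
  toFun d := fun i => Bool.xor (x i) (d i)
  invFun d := fun i => Bool.xor (x i) (d i)
  left_inv d := by
    funext i
    show Bool.xor (x i) (Bool.xor (x i) (d i)) = d i
    cases x i <;> cases d i <;> rfl
  right_inv d := by
    funext i
    show Bool.xor (x i) (Bool.xor (x i) (d i)) = d i
    cases x i <;> cases d i <;> rfl

omit [Fintype K] [Algebra (ZMod 2) K] in
/-- The value bits of `x ⊕ d` are the value bits of `x` flipped along `T e d x`. -/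
theorem cubeCoords_xor (e : K ≃+ (Fin n → ZMod 2)) (d x : Fin n → Bool) :
    cubeCoords e (fun i => Bool.xor (x i) (d i)) = fun j => Bool.xor (cubeCoords e x j) (T e d x j) := by
  funext j
  simp only [T]
  cases cubeCoords e x j <;> cases cubeCoords e (fun i => Bool.xor (x i) (d i)) j <;> rfl

omit [Fintype K] [Algebra (ZMod 2) K] in
/-- Multilinearity: `Σ_d ∏_i f i (d i) = ∏_i (f i false + f i true)`. -/
theorem sum_prod_bool (f : Fin n → Bool → ℝ) :
    ∑ d : Fin n → Bool, ∏ i, f i (d i) = ∏ i, (f i false + f i true) := by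
  classical
  have hb : ∀ i, f i false + f i true = ∑ b : Bool, f i b := fun i => by
    rw [Fintype.sum_bool, add_comm]
  simp_rw [hb]
  rw [Finset.prod_univ_sum]
  simp only [Fintype.piFinset_univ]

omit [Fintype K] [Algebra (ZMod 2) K] in
/-- `ℓ¹` mass of a product weight: `Σ_d |pw S c s d| = ∏_{i∈S} (|c i| + |s i|)`. -/
theorem sum_abs_pw_eq (S : Finset (Fin n)) (c s : Fin n → ℝ) :
    ∑ d : Fin n → Bool, |pw S c s d| = ∏ i ∈ S, (|c i| + |s i|) := by
  classical
  have habs : ∀ d : Fin n → Bool, |pw S c s d| =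
      ∏ i, (if i ∈ S then (if d i then |s i| else |c i|) else (if d i then 0 else 1)) := by
    intro d
    rw [pw, Finset.abs_prod]
    refine Finset.prod_congr rfl fun i _ => ?_
    by_cases hi : i ∈ S <;> cases d i <;> simp [hi]
  simp_rw [habs]
  rw [sum_prod_bool (fun i b => if i ∈ S then (if b then |s i| else |c i|) else (if b then 0 else 1))]
  simp only [Bool.false_eq_true, if_false, if_true]
  calc ∏ i, ((if i ∈ S then |c i| else 1) + (if i ∈ S then |s i| else 0))
      = ∏ i, (if i ∈ S then |c i| + |s i| else 1) := by
        refine Finset.prod_congr rfl fun i _ => ?_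
        by_cases hi : i ∈ S <;> simp [hi]
    _ = ∏ i ∈ S, (|c i| + |s i|) := by
        rw [Finset.prod_ite, Finset.prod_const_one, mul_one, Finset.filter_mem_eq_inter, Finset.univ_inter]

omit [Fintype K] [Algebra (ZMod 2) K] in
/-- On the unit circle `|c| + |s| ≤ √2`. -/
theorem abs_add_abs_le_sqrt_two (c s : ℝ) (h : c ^ 2 + s ^ 2 = 1) : |c| + |s| ≤ Real.sqrt 2 := by
  have hsum2 : (|c| + |s|) ^ 2 ≤ 2 := by
    have : (|c| + |s|) ^ 2 = c ^ 2 + s ^ 2 + 2 * (|c| * |s|) := by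
      rw [add_sq, sq_abs, sq_abs]; ring
    rw [this, h]
    nlinarith [sq_nonneg (|c| - |s|), sq_abs c, sq_abs s, abs_nonneg c, abs_nonneg s]
  calc |c| + |s| = Real.sqrt ((|c| + |s|) ^ 2) := (Real.sqrt_sq (by positivity)).symm
    _ ≤ Real.sqrt 2 := Real.sqrt_le_sqrt hsum2

omit [Fintype K] [Algebra (ZMod 2) K] in
/-- `ℓ¹` mass of the input weight: `Σ_d |pw| = ∏_{S}(|c|+|s|) ≤ √2^{|S|}`. -/
theorem sum_abs_pw_le (S : Finset (Fin n)) (c s : Fin n → ℝ) (hcs : ∀ i ∈ S, c i ^ 2 + s i ^ 2 = 1) :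
    ∑ d : Fin n → Bool, |pw S c s d| ≤ Real.sqrt 2 ^ S.card := by
  rw [sum_abs_pw_eq]
  calc ∏ i ∈ S, (|c i| + |s i|) ≤ ∏ i ∈ S, Real.sqrt 2 :=
        Finset.prod_le_prod (fun i _ => by positivity) fun i hi => abs_add_abs_le_sqrt_two _ _ (hcs i hi)
    _ = Real.sqrt 2 ^ S.card := Finset.prod_const _

/-! ### Dictionary: bits, field elements, signs as characters -/

omit [Fintype K] [Algebra (ZMod 2) K] in
/-- Field element to bits through `e`. -/
def bits (e : K ≃+ (Fin n → ZMod 2)) (w : K) : Fin n → Bool := fun i => decide (e w i = 1)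

omit [Fintype K] [Algebra (ZMod 2) K] in
/-- `e (toK y) = [y]` as a `ZMod 2` vector. -/
theorem e_toK (e : K ≃+ (Fin n → ZMod 2)) (y : Fin n → Bool) (i : Fin n) :
    e (toK e y) i = if y i then 1 else 0 := by
  simp [toK]

omit [Fintype K] [Algebra (ZMod 2) K] in
/-- `bits (toK y) = y`. -/
theorem bits_toK (e : K ≃+ (Fin n → ZMod 2)) (y : Fin n → Bool) : bits e (toK e y) = y := by
  funext i
  rw [bits, e_toK]
  have h10 : (1 : ZMod 2) ≠ 0 := by decide
  cases y i <;> simp [h10.symm]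

omit [Fintype K] [Algebra (ZMod 2) K] in
/-- `toK (bits w) = w`. -/
theorem toK_bits (e : K ≃+ (Fin n → ZMod 2)) (w : K) : toK e (bits e w) = w := by
  apply e.injective
  rw [toK, AddEquiv.apply_symm_apply]
  funext i
  simp only [bits, decide_eq_true_eq]
  rcases zmod_two_eq_zero_or_eq_one (e w i) with h | h <;> simp [h]

omit [Fintype K] [Algebra (ZMod 2) K] in
/-- The bit/field bijection. -/
def bitsEquiv (e : K ≃+ (Fin n → ZMod 2)) : (Fin n → Bool) ≃ K where
  toFun := toK e
  invFun := bits e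
  left_inv := bits_toK e
  right_inv := toK_bits e

omit [Fintype K] [Algebra (ZMod 2) K] in
/-- `toK` is additive along `xor`. -/
theorem toK_xor (e : K ≃+ (Fin n → ZMod 2)) (y d : Fin n → Bool) :
    toK e (fun i => Bool.xor (y i) (d i)) = toK e y + toK e d := by
  rw [toK, toK, toK, ← map_add]
  congr 1
  exact bits_xor y d

omit [Fintype K] [Algebra (ZMod 2) K] in
/-- `toK d = 0 ↔ d = 0`. -/
theorem toK_ne_zero (e : K ≃+ (Fin n → ZMod 2)) {d : Fin n → Bool} (hd : d ≠ fun _ => false) :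
    toK e d ≠ 0 := by
  intro h
  apply hd
  have := congrArg (bits e) h
  rw [bits_toK] at this
  rw [this]
  funext i
  simp [bits]

omit [Fintype K] [Algebra (ZMod 2) K] in
/-- The value coordinates are the bits of the cube. -/
theorem cubeCoords_eq_bits (e : K ≃+ (Fin n → ZMod 2)) (y : Fin n → Bool) :
    cubeCoords e y = bits e ((toK e y) ^ 3) := rfl

omit [Fintype K] [Algebra (ZMod 2) K] in
/-- The value difference pattern is the bit pattern of the field derivative `(u + α)³ + u³`. -/
theorem T_eq_bits (e : K ≃+ (Fin n → ZMod 2)) (d y : Fin n → Bool) :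
    T e d y = bits e ((toK e y + toK e d) ^ 3 + (toK e y) ^ 3) := by
  funext j
  rw [T, cubeCoords_eq_bits, cubeCoords_eq_bits, toK_xor]
  simp only [bits, map_add, Pi.add_apply]
  rcases zmod_two_eq_zero_or_eq_one (e ((toK e y) ^ 3) j) with h1 | h1 <;>
    rcases zmod_two_eq_zero_or_eq_one (e ((toK e y + toK e d) ^ 3) j) with h2 | h2 <;>
    simp [h1, h2]

omit [Fintype K] [Algebra (ZMod 2) K] in
/-- The coordinate-sum functional `w ↦ Σ_{i∈S} [w]ᵢ`. -/
def coordSum (e : K ≃+ (Fin n → ZMod 2)) (S : Finset (Fin n)) : K →+ ZMod 2 where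
  toFun w := ∑ i ∈ S, e w i
  map_zero' := by simp
  map_add' x y := by
    rw [← Finset.sum_add_distrib]
    refine Finset.sum_congr rfl fun i _ => ?_
    rw [map_add, Pi.add_apply]

omit [Fintype K] [Algebra (ZMod 2) K] in
/-- Evaluation of `coordSum`. -/
theorem coordSum_apply (e : K ≃+ (Fin n → ZMod 2)) (S : Finset (Fin n)) (w : K) :
    coordSum e S w = ∑ i ∈ S, e w i := rfl

omit [Fintype K] [Algebra (ZMod 2) K] in
/-- The sign factor is the character of a coordinate sum:
`sgn S d (bits w) = χ(Σ_{i∈S, ¬dᵢ} [w]ᵢ)`. -/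
theorem sgn_bits_eq (e : K ≃+ (Fin n → ZMod 2)) (S : Finset (Fin n)) (d : Fin n → Bool) (w : K) :
    sgn S d (bits e w) =
      if coordSum e (S.filter fun i => d i = false) w = 0 then (1 : ℝ) else -1 := by
  classical
  rw [coordSum_apply, ← prod_sign_eq, sgn, Finset.prod_filter, ← Finset.prod_filter_mul_prod_filter_not
    Finset.univ (fun i => i ∈ S)]
  rw [Finset.filter_mem_eq_inter, Finset.univ_inter]
  have h2 : ∏ i ∈ Finset.univ.filter (fun i => i ∉ S),
      (if (i ∈ S ∧ d i = false ∧ bits e w i = true) then (-1 : ℝ) else 1) = 1 := by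
    refine Finset.prod_eq_one fun i hi => ?_
    rw [Finset.mem_filter] at hi
    simp [hi.2]
  rw [h2, mul_one]
  refine Finset.prod_congr rfl fun i hi => ?_
  simp only [hi, true_and, bits, decide_eq_true_eq]
  rcases zmod_two_eq_zero_or_eq_one (e w i) with h | h <;> cases d i <;> simp [h]


end Statements

end CoreReal

/-- Registered alias (file 1/4 of the real-tilt core): the value difference is the bit pattern of the field derivative. -/
theorem stub_coreRealDictionary : ∀ {n : ℕ} {K : Type} [Field K] (e : K ≃+ (Fin n → ZMod 2)) (d y : Fin n → Bool), Summit.QuantumAdvantage.QuantumAdvantage.Theorems.SymplecticPurity.CoreReal.T e d y = Summit.QuantumAdvantage.QuantumAdvantage.Theorems.SymplecticPurity.CoreReal.bits e ((Summit.QuantumAdvantage.QuantumAdvantage.Theorems.SymplecticPurity.CoreReal.toK e y + Summit.QuantumAdvantage.QuantumAdvantage.Theorems.SymplecticPurity.CoreReal.toK e d) ^ 3 + (Summit.QuantumAdvantage.QuantumAdvantage.Theorems.SymplecticPurity.CoreReal.toK e y) ^ 3) :=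
  fun e d y => CoreReal.T_eq_bits e d y

end Summit.QuantumAdvantage.QuantumAdvantage.Theorems.SymplecticPurity

end
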